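import Summits.QuantumFields.YangMills.Theorems.FluctuationComparisonRegPrIntLS2BetaChartReadDerivCovariantTranslationClosed
import Summits.QuantumFields.YangMills.Theorems.FluctuationComparisonRegPrIntLS2BetaSecondOrderTowerSupClosed
import Summits.QuantumFields.YangMills.Theorems.FluctuationComparisonRegPrIntLS2BetaCovariantOscillationKUniformLie
import HarnessLib

/-!
# S2β · (REG-UP)′ KNOT — «C₇b's COVARIANT OSCILLATION LETTER AT LEVEL k FROM THE PHYSICAL LETTERS ONLY»: px13 g29's ✓p840162 `hOSC_of_compositeLetters` (𝔰𝔲(N)-input form ✓`…KUniformLie`)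
# INSTANTIATED on the towers `F.P K` at `D := DΨ^{U₀}_k` with (hD) ⟸ ✓(D2), (hDcov) ⟸ ✓`hDcov_closed` (β4) per direction, (hNL) ⟸ ✓`norm_sub_fderiv_chartRead_iter_le` (hNL closed):
# what stays displayed are the (0.4) loop guards `α`, the BKG classes `δ`, the line recursion `ε`, the chart windows, the covariant μ-word oscillation `c₀` of the fine datum and the
# one-step second-order remainders `r` — NO derivative∕map letter

Cell `ym3-torus` (YM ladder rung R3 = continuum `SU(2)` Yang–Mills on the three-torus at fixed lattice data — a RUNG: NOT d = 4, NOT infinite volume, NOT a mass gap,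
NOT Clay).  Width seat «width 12» `ym3-torus-px12` (gen 27); crux `stmt-QuantumFields-20520`, LINE g18-1 S2β, node (REG-UP)′.  `--kind proof --supports stmt-QuantumFields-20520 --as helper`,
count-neutral, DEFINITION-FREE (0 `def`, 0 `instance`, 0 `notation`, 0 `sorry`, default heartbeats).  `SU(N)`, towers `F.P K`, `k + 2 ≤ m + K`.

WHAT IS PROVED (sorry-free).  ★★★**`hOSC_regUp_closed`** — for a tower of 𝔰𝔲(N)-valued data `Xd i` on `F.P K` and a background `U₀`: C₇b ✓p838589's covariant oscillation letter for the level-`k` datum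
`Xd k` against `Ū^kU₀` on every corner box, with `O = 2·(d·3L)·((β + Λ_D·(ℓ·c₀)) + 2ρ₂)`, `Λ_D = Λ·L^k`, `β = 2·ε_k·(Λ·L^k·‖Xd 0‖) + (Σ_{i<k} Λ·L^{k−1−i}·(β_i·(Λ·L^i)))·‖Xd 0‖`,
`ρ₂ = Σ_{i<k} Λ·L^{k−1−i}·r(i+1)`, `Λ = (1+4(d+2))·exp((d+2)(422+1616(d+2))·Σ_{j<k} α_j)`, `β_i = 2·67ℓ(κ_i + (κ_i + L^{k−i}(2ε_i+δ_i)))∕a`.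

HONEST SCOPE.  The knot of the (REG-UP)′ node over landed letters; nothing of Bałaban's renormalisation-group analysis proved ([Balaban1985Averaging] Prop. 4 (128)–(135) pp.37–38, [Balaban1985RegularSpaces]
(1.36) are the printed loci); displayed HYPOTHESES: guards `α`, classes `δ`, recursion `ε`, windows, `c₀` (covariant μ-word oscillation of `Xd 0` over `L^k` steps, every direction), `r` (one-step second
order); K-uniformity of `O` is the planner's arithmetic on these profiles (px13 g29 03:15:52Z: ONE scale power per level — the cross-term question for V4's `ha` stays a planner gap); GAP♯∘
(`stub_uniformFibreGapOrbit`, registry 3732b7df UNTOUCHED, 0∕5), the five registered stubs, S2β, crux 20520, 19936, 19200, `YM3TorusSU2` — NOT proved; rung R3 — NOT d = 4, NOT infinite volume,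
NOT a mass gap, NOT Clay; the Yang–Mills mass gap is NOT proved.
-/

set_option autoImplicit false

noncomputable section

open scoped Matrix.Norms.L2Operator Topology
open Filter Set Function

namespace Summit.QuantumFields.YangMills.Theorems.FluctuationComparisonRegPrIntLS2BetaCovariantOscillationRegUpClosed

open Literature.MathematicalPhysics.QuantumFieldTheory.Balaban1983to89
open Literature.MathematicalPhysics.QuantumFieldTheory.Balaban1983to89.HaarExponentialChart
open Literature.MathematicalPhysics.QuantumFieldTheory.Balaban1983to89.HaarExponentialChart.IsChartRep
open Literature.MathematicalPhysics.QuantumFieldTheory.Balaban1983to89.BlockAveraging (Small Idx avgFun loopHol blockAvg blockAvg_avg)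
open Literature.MathematicalPhysics.QuantumFieldTheory.Balaban1983to89.ExpMeanLog (expMeanLogSU deltaSU)
open Literature.MathematicalPhysics.QuantumFieldTheory.Balaban1983to89.Node00
open Literature.MathematicalPhysics.QuantumFieldTheory.Balaban1983to89.T3ContinuumYM3Torus
open Literature.MathematicalPhysics.QuantumFieldTheory.Balaban1983to89.T4Continuum (walk walkEnd holAt Letter)
open Literature.MathematicalPhysics.QuantumFieldTheory.Balaban1983to89.B10Eq47AxialChi (rowProd)
open Summit.QuantumFields.YangMills.BalabanUVNodes.N09ChartReadAveragingSmooth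
open Summit.QuantumFields.YangMills.Theorems.FluctuationComparisonRegPrIntLS2BetaChartReadGaugeCovariance (conj_mem_lie)
open Summit.QuantumFields.YangMills.Theorems.FluctuationComparisonRegPrIntLS2BetaChartReadDerivKStepSup (norm_fderiv_chartRead_iter_apply_le_exp)
open Summit.QuantumFields.YangMills.Theorems.FluctuationComparisonRegPrIntLS2BetaChartReadDerivCovariantTranslationClosed (hDcov_closed)
open Summit.QuantumFields.YangMills.Theorems.FluctuationComparisonRegPrIntLS2BetaSecondOrderTowerSupClosed (norm_sub_fderiv_chartRead_iter_le)
open Summit.QuantumFields.YangMills.Theorems.FluctuationComparisonRegPrIntLS2BetaCovariantOscillationKUniformLie (hOSC_of_compositeLetters_lie)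

variable {N : ℕ} [NeZero N] (F : T3Family)

/-- ★★★ **(REG-UP)′ CLOSED OVER THE PHYSICAL LETTERS**: C₇b's covariant oscillation letter for the level-`k` datum `Xd k` against `Ū^kU₀` on the corner box at `y′` (directions `μ, ν`),
`O = 2·(d·3L)·((β + Λ_D·(ℓ·c₀)) + 2ρ₂)` with `β, Λ_D, ρ₂` the EXPLICIT letters of ✓β4, ✓(D2), ✓(hNL closed) (module docstring). [cite: Balaban1985Averaging, (8)-(9) p.18, (22) p.21, Prop. 4 (128)-(135) pp.37-38; Balaban1987RG1, (0.3)-(0.4), (0.11) pp.252-253] -/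
theorem hOSC_regUp_closed {K k : ℕ} (hk2 : k + 2 ≤ F.m + K) (U₀ : GaugeField (F.P K) 0 (SU N)) (Xd : (i : ℕ) → (PBond (F.P K) i → (specialUnitaryLogChart (Fin N)).lie))
    {α δ ε r : ℕ → ℝ} {ρ a ℓ c₀ : ℝ} (hα0 : ∀ l, 0 ≤ α l) (hα24 : ∀ l, α l ≤ 1 / 24) (hαδ : ∀ l, α l < deltaSU (Fin N))
    (hαU : (∀ l, l < k → ∀ (c : PBond (F.P K) (l + 1)) (idx : Idx (F.P K)), dist1 (loopHol (Averaging.iter (fun i => blockAvg (P := F.P K) (j := i) (expMeanLogSU (n := Fin N))) l U₀) c idx) ≤ α l))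
    (hρ0 : 0 < ρ) (hρ : ρ ≤ innerRadius (specialUnitaryLogChart (Fin N))) (hα4 : ∀ l, 4 * α l ≤ ρ)
    (hδ0 : ∀ l, 0 ≤ δ l) (hδ : ∀ l, l < k → PlaqSmall (δ l) (Averaging.iter (fun i => blockAvg (P := F.P K) (j := i) (expMeanLogSU (n := Fin N))) l U₀))
    (hε0 : ε 0 = 0) (hεnn : ∀ i, 0 ≤ ε i) (hε : ∀ i, i < k → ((F.P K).L : ℝ) * ε i + 2 * α i ≤ ε (i + 1))
    (hwin : ∀ i, i < k → 100 * (((((F.P K).d + 2) * (F.P K).L : ℕ) : ℝ) * (((((F.P K).d - 1 : ℕ) : ℝ) * ((2 * (F.P K).L : ℕ) : ℝ) * δ i) + (((((F.P K).d - 1 : ℕ) : ℝ) * ((2 * (F.P K).L : ℕ) : ℝ) * δ i) + ((((F.P K).L ^ (k - i) : ℕ) : ℝ) * (2 * ε i + δ i))))) ≤ ρ)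
    (ha0 : 0 < a) (ha : 100 * (((((F.P K).d + 2) * (F.P K).L : ℕ) : ℝ) * (Real.exp a - 1)) ≤ ρ)
    (hℓc₀ : 0 ≤ ℓ * c₀)
    (hc₀ : ∀ (μ : Fin (F.P K).d) (b : PBond (F.P K) 0), ‖(((fun b : PBond (F.P K) 0 => (⟨((rowProd U₀ b.src μ ((F.P K).L ^ k) : SU N) : Matrix (Fin N) (Fin N) ℂ) * (((Xd 0) (b.translate (Site.scaleTo k ((0 : Site (F.P K) k).shift μ))) : (specialUnitaryLogChart (Fin N)).lie) : Matrix (Fin N) (Fin N) ℂ) * star ((rowProd U₀ b.src μ ((F.P K).L ^ k) : SU N) : Matrix (Fin N) (Fin N) ℂ), conj_mem_lie (rowProd U₀ b.src μ ((F.P K).L ^ k)) ((Xd 0) (b.translate (Site.scaleTo k ((0 : Site (F.P K) k).shift μ))))⟩ : (specialUnitaryLogChart (Fin N)).lie)) b : (specialUnitaryLogChart (Fin N)).lie) : Matrix (Fin N) (Fin N) ℂ) - (((Xd 0) b : (specialUnitaryLogChart (Fin N)).lie) : Matrix (Fin N) (Fin N) ℂ)‖ ≤ ℓ * c₀)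
    (hr0 : ∀ l, 0 ≤ r l)
    (hr : ∀ i, i < k → ∀ c' : PBond (F.P K) (i + 1),
      ‖((Xd (i + 1) c' : (specialUnitaryLogChart (Fin N)).lie) : Matrix (Fin N) (Fin N) ℂ) - (((fderiv ℝ (fun (B : PBond (F.P K) i → (specialUnitaryLogChart (Fin N)).lie) (c' : PBond (F.P K) (i + 1)) => (isChartRep_specialUnitaryGroup (n := Fin N)).logChart (avgFun (expMeanLogSU (n := Fin N)) (fun c => (isChartRep_specialUnitaryGroup (n := Fin N)).expChart (B c) * (Averaging.iter (fun i => blockAvg (P := F.P K) (j := i) (expMeanLogSU (n := Fin N))) i U₀) c) c' * (avgFun (expMeanLogSU (n := Fin N)) ((Averaging.iter (fun i => blockAvg (P := F.P K) (j := i) (expMeanLogSU (n := Fin N))) i U₀)) c')⁻¹)) 0) (Xd i) c' : (specialUnitaryLogChart (Fin N)).lie) : Matrix (Fin N) (Fin N) ℂ)‖ ≤ r (i + 1))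
    {μ ν : Fin (F.P K).d} (y' : Site (F.P K) (k + 1)) (b b' : PBond (F.P K) k)
    (hb : blockOf b.src = y' ∨ blockOf b.src = y'.shift μ ∨ blockOf b.src = y'.shift ν ∨ blockOf b.src = (y'.shift μ).shift ν)
    (hb' : blockOf b'.src = y' ∨ blockOf b'.src = y'.shift μ ∨ blockOf b'.src = y'.shift ν ∨ blockOf b'.src = (y'.shift μ).shift ν)
    (hdir : b.dir = b'.dir) :
    ‖(((T4AxialGaugeSmallField.axialGauge (Averaging.iter (fun i => blockAvg (P := F.P K) (j := i) (expMeanLogSU (n := Fin N))) k U₀) (fun κ : Fin (F.P K).d => (((emb y' κ).val : ℕ) : ℤ) - ((((F.P K).L - 1) / 2 : ℕ) : ℤ)) (fun κ : Fin (F.P K).d => (((emb y' κ).val : ℕ) : ℤ) + (((if κ = μ then ((F.P K).L : ℤ) else 0) + (if κ = ν then ((F.P K).L : ℤ) else 0)) + ((((F.P K).L - 1) / 2 : ℕ) : ℤ)) + 1) b.src : SU N)) : Matrix (Fin N) (Fin N) ℂ) * ((Xd k b : (specialUnitaryLogChart (Fin N)).lie) : Matrix (Fin N) (Fin N) ℂ)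 * star (((T4AxialGaugeSmallField.axialGauge (Averaging.iter (fun i => blockAvg (P := F.P K) (j := i) (expMeanLogSU (n := Fin N))) k U₀) (fun κ : Fin (F.P K).d => (((emb y' κ).val : ℕ) : ℤ) - ((((F.P K).L - 1) / 2 : ℕ) : ℤ)) (fun κ : Fin (F.P K).d => (((emb y' κ).val : ℕ) : ℤ) + (((if κ = μ then ((F.P K).L : ℤ) else 0) + (if κ = ν then ((F.P K).L : ℤ) else 0)) + ((((F.P K).L - 1) / 2 : ℕ) : ℤ)) + 1) b.src : SU N)) : Matrix (Fin N) (Fin N) ℂ) -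
      (((T4AxialGaugeSmallField.axialGauge (Averaging.iter (fun i => blockAvg (P := F.P K) (j := i) (expMeanLogSU (n := Fin N))) k U₀) (fun κ : Fin (F.P K).d => (((emb y' κ).val : ℕ) : ℤ) - ((((F.P K).L - 1) / 2 : ℕ) : ℤ)) (fun κ : Fin (F.P K).d => (((emb y' κ).val : ℕ) : ℤ) + (((if κ = μ then ((F.P K).L : ℤ) else 0) + (if κ = ν then ((F.P K).L : ℤ) else 0)) + ((((F.P K).L - 1) / 2 : ℕ) : ℤ)) + 1) b'.src : SU N)) : Matrix (Fin N) (Fin N) ℂ) * ((Xd k b' : (specialUnitaryLogChart (Fin N)).lie) : Matrix (Fin N) (Fin N) ℂ) * star (((T4AxialGaugeSmallField.axialGauge (Averaging.iter (fun i => blockAvg (P := F.P K) (j := i) (expMeanLogSU (n := Fin N))) k U₀) (fun κ : Fin (F.P K).d => (((emb y' κ).val : ℕ) : ℤ) - ((((F.P K).L - 1) / 2 : ℕ) : ℤ)) (fun κ : Fin (F.P K).d => (((emb y' κ).val : ℕ) : ℤ) + (((if κ = μ then ((F.P K).L : ℤ) else 0) + (if κ = ν then ((F.P K).L : ℤ)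 else 0)) + ((((F.P K).L - 1) / 2 : ℕ) : ℤ)) + 1) b'.src : SU N)) : Matrix (Fin N) (Fin N) ℂ)‖ ≤
      2 * ((((F.P K).d : ℕ) : ℝ) * ((3 * (F.P K).L : ℕ) : ℝ)) * (((2 * ε k * (((1 + 4 * (((F.P K).d + 2 : ℕ) : ℝ)) * Real.exp ((((F.P K).d + 2 : ℕ) : ℝ) * (422 + 1616 * (((F.P K).d + 2 : ℕ) : ℝ)) * ∑ j ∈ Finset.range k, α j)) * ((F.P K).L : ℝ) ^ k * ‖Xd 0‖) + (∑ i ∈ Finset.range k, ((1 + 4 * (((F.P K).d + 2 : ℕ) : ℝ)) * Real.exp ((((F.P K).d + 2 : ℕ) : ℝ) * (422 + 1616 * (((F.P K).d + 2 : ℕ) : ℝ)) * ∑ j ∈ Finset.range k, α j)) * ((F.P K).L : ℝ) ^ (k - 1 - i) * ((2 * (67 * (((((F.P K).d + 2) * (F.P K).L : ℕ) : ℝ) * (((((F.P K).d - 1 : ℕ) : ℝ) * ((2 * (F.P K).L : ℕ) : ℝ) * δ i) + (((((F.P K).d - 1 : ℕ) : ℝ) * ((2 * (F.P K).L : ℕ)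 : ℝ) * δ i) + ((((F.P K).L ^ (k - i) : ℕ) : ℝ) * (2 * ε i + δ i)))))) / a) * (((1 + 4 * (((F.P K).d + 2 : ℕ) : ℝ)) * Real.exp ((((F.P K).d + 2 : ℕ) : ℝ) * (422 + 1616 * (((F.P K).d + 2 : ℕ) : ℝ)) * ∑ j ∈ Finset.range k, α j)) * ((F.P K).L : ℝ) ^ i))) * ‖Xd 0‖) + (((1 + 4 * (((F.P K).d + 2 : ℕ) : ℝ)) * Real.exp ((((F.P K).d + 2 : ℕ) : ℝ) * (422 + 1616 * (((F.P K).d + 2 : ℕ) : ℝ)) * ∑ j ∈ Finset.range k, α j)) * ((F.P K).L : ℝ) ^ k) * (ℓ * c₀)) + 2 * (∑ i ∈ Finset.range k, ((1 + 4 * (((F.P K).d + 2 : ℕ) : ℝ)) * Real.exp ((((F.P K).d + 2 : ℕ) : ℝ) * (422 + 1616 * (((F.P K).d + 2 : ℕ) : ℝ)) * ∑ j ∈ Finset.range k, α j)) * ((F.P K).L : ℝ) ^ (k - 1 - i) * r (i + 1))) := by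
  have hk : k ≤ F.m + K := by omega
  have hk1 : k + 1 ≤ F.m + K := by omega
  have hl : k + 1 ≤ (F.P K).m + (F.P K).K := by show k + 1 ≤ F.m + K; omega
  have hl2 : k + 2 ≤ (F.P K).m + (F.P K).K := by show k + 2 ≤ F.m + K; omega
  -- (hDlin): the derivative is linear
  have hDlin : ∀ Y Y' : PBond (F.P K) 0 → (specialUnitaryLogChart (Fin N)).lie, (fun (Y : PBond (F.P K) 0 → (specialUnitaryLogChart (Fin N)).lie) (c : PBond (F.P K) k) => (((fderiv ℝ (fun (A : PBond (F.P K) 0 → (specialUnitaryLogChart (Fin N)).lie) (c : PBond (F.P K) k) => (isChartRep_specialUnitaryGroup (n := Fin N)).logChart (Averaging.iter (fun i => blockAvg (P := F.P K) (j := i) (expMeanLogSU (n := Fin N))) k (fun b => (isChartRep_specialUnitaryGroup (n := Fin N)).expChart (A b) * U₀ b) c * (Averaging.iter (fun i => blockAvg (P := F.P K) (j := i) (expMeanLogSU (n := Fin N))) k U₀ c)⁻¹)) 0) Y c : (specialUnitaryLogChart (Fin N)).lie) : Matrix (Fin N) (Fin N) ℂ)) (fun bb => Y bb - Y' bb) =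 fun c => (fun (Y : PBond (F.P K) 0 → (specialUnitaryLogChart (Fin N)).lie) (c : PBond (F.P K) k) => (((fderiv ℝ (fun (A : PBond (F.P K) 0 → (specialUnitaryLogChart (Fin N)).lie) (c : PBond (F.P K) k) => (isChartRep_specialUnitaryGroup (n := Fin N)).logChart (Averaging.iter (fun i => blockAvg (P := F.P K) (j := i) (expMeanLogSU (n := Fin N))) k (fun b => (isChartRep_specialUnitaryGroup (n := Fin N)).expChart (A b) * U₀ b) c * (Averaging.iter (fun i => blockAvg (P := F.P K) (j := i) (expMeanLogSU (n := Fin N))) k U₀ c)⁻¹)) 0) Y c : (specialUnitaryLogChart (Fin N)).lie) : Matrix (Fin N) (Fin N) ℂ)) Y c - (fun (Y : PBond (F.P K) 0 → (specialUnitaryLogChart (Fin N)).lie) (c : PBond (F.P K) k) => (((fderiv ℝ (fun (A : PBond (F.P K) 0 → (specialUnitaryLogChart (Fin N)).lie) (c : PBond (F.P K) k) => (isChartRep_specialUnitaryGroup (n := Fin N)).logChart (Averaging.iter (fun i => blockAvg (P := F.P K) (j := i) (expMeanLogSU (n := Fin N))) k (fun b => (isChartRep_specialUnitaryGroup (n :=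 Fin N)).expChart (A b) * U₀ b) c * (Averaging.iter (fun i => blockAvg (P := F.P K) (j := i) (expMeanLogSU (n := Fin N))) k U₀ c)⁻¹)) 0) Y c : (specialUnitaryLogChart (Fin N)).lie) : Matrix (Fin N) (Fin N) ℂ)) Y' c := by
    intro Y Y'
    funext c
    have e : (fun bb => Y bb - Y' bb) = Y - Y' := rfl
    simp only [e, map_sub, Pi.sub_apply, Submodule.coe_sub]
  -- (hD): the sup row (✓(D2))
  have hD : ∀ (Y : PBond (F.P K) 0 → (specialUnitaryLogChart (Fin N)).lie) (s : ℝ), (∀ bb, ‖((Y bb : (specialUnitaryLogChart (Fin N)).lie) : Matrix (Fin N) (Fin N) ℂ)‖ ≤ s) → ∀ c, ‖(fun (Y : PBond (F.P K) 0 → (specialUnitaryLogChart (Fin N)).lie) (c : PBond (F.P K) k) => (((fderiv ℝ (fun (A : PBond (F.P K) 0 → (specialUnitaryLogChart (Fin N)).lie) (c : PBond (F.P K) k) => (isChartRep_specialUnitaryGroup (n := Fin N)).logChart (Averaging.iter (fun i => blockAvg (P := F.P K) (j := i) (expMeanLogSU (n := Fin N))) k (fun b => (isChartRep_specialUnitaryGroup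 (n := Fin N)).expChart (A b) * U₀ b) c * (Averaging.iter (fun i => blockAvg (P := F.P K) (j := i) (expMeanLogSU (n := Fin N))) k U₀ c)⁻¹)) 0) Y c : (specialUnitaryLogChart (Fin N)).lie) : Matrix (Fin N) (Fin N) ℂ)) Y c‖ ≤ (((1 + 4 * (((F.P K).d + 2 : ℕ) : ℝ)) * Real.exp ((((F.P K).d + 2 : ℕ) : ℝ) * (422 + 1616 * (((F.P K).d + 2 : ℕ) : ℝ)) * ∑ j ∈ Finset.range k, α j)) * ((F.P K).L : ℝ) ^ k) * s := by
    intro Y s hs c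
    have hs0 : 0 ≤ s := (norm_nonneg _).trans (hs ⟨default, c.dir⟩)
    have hYs : ‖Y‖ ≤ s := (pi_norm_le_iff_of_nonneg hs0).2 fun bb => by rw [← Submodule.norm_coe]; exact hs bb
    refine (norm_fderiv_chartRead_iter_apply_le_exp (P := F.P K) (N := N) U₀ Y hα0 hα24 hαδ k hαU c).trans ?_
    exact mul_le_mul_of_nonneg_left hYs (by positivity)
  -- (hDcov): ✓β4 per direction, with the `c₀` letter
  have hS0 : 0 ≤ (∑ i ∈ Finset.range k, ((1 + 4 * (((F.P K).d + 2 : ℕ) : ℝ)) * Real.exp ((((F.P K).d + 2 : ℕ) : ℝ) * (422 + 1616 * (((F.P K).d + 2 : ℕ) : ℝ)) * ∑ j ∈ Finset.range k, α j)) * ((F.P K).L : ℝ) ^ (k - 1 - i) * ((2 * (67 * (((((F.P K).d + 2) * (F.P K).L : ℕ) : ℝ) * (((((F.P K).d - 1 : ℕ) : ℝ) * ((2 * (F.P K).L : ℕ) : ℝ) * δ i) + (((((F.P K).d - 1 : ℕ) : ℝ) * ((2 * (F.P K).L : ℕ) : ℝ) * δ i) + ((((F.P K).L ^ (k - i) :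 ℕ) : ℝ) * (2 * ε i + δ i)))))) / a) * (((1 + 4 * (((F.P K).d + 2 : ℕ) : ℝ)) * Real.exp ((((F.P K).d + 2 : ℕ) : ℝ) * (422 + 1616 * (((F.P K).d + 2 : ℕ) : ℝ)) * ∑ j ∈ Finset.range k, α j)) * ((F.P K).L : ℝ) ^ i))) := Finset.sum_nonneg fun i _ => by have := hδ0 i; have := hεnn i; positivity
  have hDcov : ∀ (y : Site (F.P K) k) (μ' : Fin (F.P K).d), ∃ Y' : PBond (F.P K) 0 → (specialUnitaryLogChart (Fin N)).lie,
      (∀ bb, ‖((Y' bb : (specialUnitaryLogChart (Fin N)).lie) : Matrix (Fin N) (Fin N) ℂ) - (((Xd 0) bb : (specialUnitaryLogChart (Fin N)).lie) : Matrix (Fin N) (Fin N) ℂ)‖ ≤ ℓ * c₀) ∧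
      ∀ κ : Fin (F.P K).d, ‖((Averaging.iter (fun i => blockAvg (P := F.P K) (j := i) (expMeanLogSU (n := Fin N))) k U₀ ⟨y, μ'⟩ : SU N) : Matrix (Fin N) (Fin N) ℂ) * (fun (Y : PBond (F.P K) 0 → (specialUnitaryLogChart (Fin N)).lie) (c : PBond (F.P K) k) => (((fderiv ℝ (fun (A : PBond (F.P K) 0 → (specialUnitaryLogChart (Fin N)).lie) (c : PBond (F.P K) k) => (isChartRep_specialUnitaryGroup (n := Fin N)).logChart (Averaging.iter (fun i => blockAvg (P := F.P K) (j := i) (expMeanLogSU (n := Fin N))) k (fun b => (isChartRep_specialUnitaryGroup (n := Fin N)).expChart (A b) * U₀ b) c * (Averaging.iter (fun i => blockAvg (P := F.P K) (j := i) (expMeanLogSU (n := Fin N))) k U₀ c)⁻¹)) 0) Y c : (specialUnitaryLogChart (Fin N)).lie) : Matrix (Fin N) (Fin N) ℂ)) (Xd 0) ⟨y.shift μ', κ⟩ *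
          star ((Averaging.iter (fun i => blockAvg (P := F.P K) (j := i) (expMeanLogSU (n := Fin N))) k U₀ ⟨y, μ'⟩ : SU N) : Matrix (Fin N) (Fin N) ℂ) - (fun (Y : PBond (F.P K) 0 → (specialUnitaryLogChart (Fin N)).lie) (c : PBond (F.P K) k) => (((fderiv ℝ (fun (A : PBond (F.P K) 0 → (specialUnitaryLogChart (Fin N)).lie) (c : PBond (F.P K) k) => (isChartRep_specialUnitaryGroup (n := Fin N)).logChart (Averaging.iter (fun i => blockAvg (P := F.P K) (j := i) (expMeanLogSU (n := Fin N))) k (fun b => (isChartRep_specialUnitaryGroup (n := Fin N)).expChart (A b) * U₀ b) c * (Averaging.iter (fun i => blockAvg (P := F.P K) (j := i) (expMeanLogSU (n := Fin N))) k U₀ c)⁻¹)) 0) Y c : (specialUnitaryLogChart (Fin N)).lie) : Matrix (Fin N) (Fin N) ℂ)) Y' ⟨y, κ⟩‖ ≤ (2 * ε k * (((1 + 4 * (((F.P K).d + 2 : ℕ) : ℝ)) * Real.exp ((((F.P K).d + 2 : ℕ) : ℝ) * (422 + 1616 * (((F.P K).d + 2 : ℕ) : ℝ)) * ∑ j ∈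 Finset.range k, α j)) * ((F.P K).L : ℝ) ^ k * ‖Xd 0‖) + (∑ i ∈ Finset.range k, ((1 + 4 * (((F.P K).d + 2 : ℕ) : ℝ)) * Real.exp ((((F.P K).d + 2 : ℕ) : ℝ) * (422 + 1616 * (((F.P K).d + 2 : ℕ) : ℝ)) * ∑ j ∈ Finset.range k, α j)) * ((F.P K).L : ℝ) ^ (k - 1 - i) * ((2 * (67 * (((((F.P K).d + 2) * (F.P K).L : ℕ) : ℝ) * (((((F.P K).d - 1 : ℕ) : ℝ) * ((2 * (F.P K).L : ℕ) : ℝ) * δ i) + (((((F.P K).d - 1 : ℕ) : ℝ) * ((2 * (F.P K).L : ℕ) : ℝ) * δ i) + ((((F.P K).L ^ (k - i) : ℕ) : ℝ) * (2 * ε i + δ i)))))) / a) * (((1 + 4 * (((F.P K).d + 2 : ℕ) : ℝ)) * Real.exp ((((F.P K).d + 2 : ℕ) : ℝ) * (422 + 1616 * (((F.P K).d + 2 : ℕ) : ℝ)) * ∑ j ∈ Finset.range k, α j)) * ((F.P K).L : ℝ) ^ i))) * ‖Xd 0‖) := by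
    intro y μ'
    exact ⟨(fun b : PBond (F.P K) 0 => (⟨((rowProd U₀ b.src μ' ((F.P K).L ^ k) : SU N) : Matrix (Fin N) (Fin N) ℂ) * (((Xd 0) (b.translate (Site.scaleTo k ((0 : Site (F.P K) k).shift μ'))) : (specialUnitaryLogChart (Fin N)).lie) : Matrix (Fin N) (Fin N) ℂ) * star ((rowProd U₀ b.src μ' ((F.P K).L ^ k) : SU N) : Matrix (Fin N) (Fin N) ℂ), conj_mem_lie (rowProd U₀ b.src μ' ((F.P K).L ^ k)) ((Xd 0) (b.translate (Site.scaleTo k ((0 : Site (F.P K) k).shift μ'))))⟩ : (specialUnitaryLogChart (Fin N)).lie)), hc₀ μ', fun κ =>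
      hDcov_closed F hk1 U₀ μ' (Xd 0) hα0 hα24 hαδ hαU hρ0 hρ hα4 hδ0 hδ hε0 hεnn hε hwin ha0 ha y κ⟩
  -- (hNL): ✓(hNL closed)
  have hNL : ∀ c : PBond (F.P K) k, ‖((Xd k c : (specialUnitaryLogChart (Fin N)).lie) : Matrix (Fin N) (Fin N) ℂ) - (fun (Y : PBond (F.P K) 0 → (specialUnitaryLogChart (Fin N)).lie) (c : PBond (F.P K) k) => (((fderiv ℝ (fun (A : PBond (F.P K) 0 → (specialUnitaryLogChart (Fin N)).lie) (c : PBond (F.P K) k) => (isChartRep_specialUnitaryGroup (n := Fin N)).logChart (Averaging.iter (fun i => blockAvg (P := F.P K) (j := i) (expMeanLogSU (n := Fin N))) k (fun b => (isChartRep_specialUnitaryGroup (n := Fin N)).expChart (A b) * U₀ b) c * (Averaging.iter (fun i => blockAvg (P := F.P K) (j := i) (expMeanLogSU (n := Fin N))) k U₀ c)⁻¹)) 0) Y c : (specialUnitaryLogChart (Fin N)).lie) : Matrix (Fin N) (Fin N) ℂ)) (Xd 0) c‖ ≤ (∑ i ∈ Finset.range k, ((1 + 4 * (((F.P K).d + 2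 : ℕ) : ℝ)) * Real.exp ((((F.P K).d + 2 : ℕ) : ℝ) * (422 + 1616 * (((F.P K).d + 2 : ℕ) : ℝ)) * ∑ j ∈ Finset.range k, α j)) * ((F.P K).L : ℝ) ^ (k - 1 - i) * r (i + 1)) := fun c =>
    norm_sub_fderiv_chartRead_iter_le F hk U₀ hα0 hα24 hαδ hr0 hαU Xd hr c
  -- positivity of `O`'s bracket
  have hρ2 : 0 ≤ (∑ i ∈ Finset.range k, ((1 + 4 * (((F.P K).d + 2 : ℕ) : ℝ)) * Real.exp ((((F.P K).d + 2 : ℕ) : ℝ) * (422 + 1616 * (((F.P K).d + 2 : ℕ) : ℝ)) * ∑ j ∈ Finset.range k, α j)) * ((F.P K).L : ℝ) ^ (k - 1 - i) * r (i + 1)) := Finset.sum_nonneg fun i _ => by have := hr0 (i + 1); positivity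
  have hβ : 0 ≤ (2 * ε k * (((1 + 4 * (((F.P K).d + 2 : ℕ) : ℝ)) * Real.exp ((((F.P K).d + 2 : ℕ) : ℝ) * (422 + 1616 * (((F.P K).d + 2 : ℕ) : ℝ)) * ∑ j ∈ Finset.range k, α j)) * ((F.P K).L : ℝ) ^ k * ‖Xd 0‖) + (∑ i ∈ Finset.range k, ((1 + 4 * (((F.P K).d + 2 : ℕ) : ℝ)) * Real.exp ((((F.P K).d + 2 : ℕ) : ℝ) * (422 + 1616 * (((F.P K).d + 2 : ℕ) : ℝ)) * ∑ j ∈ Finset.range k, α j)) * ((F.P K).L : ℝ) ^ (k - 1 - i) * ((2 * (67 * (((((F.P K).d + 2) * (F.P K).L : ℕ) : ℝ) * (((((F.P K).d - 1 : ℕ) : ℝ) * ((2 * (F.P K).L : ℕ) : ℝ) * δ i) + (((((F.P K).d - 1 : ℕ) : ℝ) * ((2 * (F.P K).L : ℕ) : ℝ) * δ i) + ((((F.P K).L ^ (k - i) : ℕ) : ℝ) * (2 * ε i + δ i)))))) / a) * (((1 + 4 * (((F.P K).d + 2 : ℕ) : ℝ)) * Real.exp ((((F.P K).d + 2 : ℕ)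 : ℝ) * (422 + 1616 * (((F.P K).d + 2 : ℕ) : ℝ)) * ∑ j ∈ Finset.range k, α j)) * ((F.P K).L : ℝ) ^ i))) * ‖Xd 0‖) := by have := hεnn k; positivity
  have hpos : 0 ≤ ((2 * ε k * (((1 + 4 * (((F.P K).d + 2 : ℕ) : ℝ)) * Real.exp ((((F.P K).d + 2 : ℕ) : ℝ) * (422 + 1616 * (((F.P K).d + 2 : ℕ) : ℝ)) * ∑ j ∈ Finset.range k, α j)) * ((F.P K).L : ℝ) ^ k * ‖Xd 0‖) + (∑ i ∈ Finset.range k, ((1 + 4 * (((F.P K).d + 2 : ℕ) : ℝ)) * Real.exp ((((F.P K).d + 2 : ℕ) : ℝ) * (422 + 1616 * (((F.P K).d + 2 : ℕ) : ℝ)) * ∑ j ∈ Finset.range k, α j)) * ((F.P K).L : ℝ) ^ (k - 1 - i) * ((2 * (67 * (((((F.P K).d + 2) * (F.P K).L : ℕ) : ℝ) * (((((F.P K).d - 1 : ℕ) : ℝ) * ((2 * (F.P K).L : ℕ) : ℝ) * δ i) + (((((F.P K).d - 1 : ℕ) : ℝ) * ((2 * (F.P K).L : ℕ) : ℝ) *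 δ i) + ((((F.P K).L ^ (k - i) : ℕ) : ℝ) * (2 * ε i + δ i)))))) / a) * (((1 + 4 * (((F.P K).d + 2 : ℕ) : ℝ)) * Real.exp ((((F.P K).d + 2 : ℕ) : ℝ) * (422 + 1616 * (((F.P K).d + 2 : ℕ) : ℝ)) * ∑ j ∈ Finset.range k, α j)) * ((F.P K).L : ℝ) ^ i))) * ‖Xd 0‖) + (((1 + 4 * (((F.P K).d + 2 : ℕ) : ℝ)) * Real.exp ((((F.P K).d + 2 : ℕ) : ℝ) * (422 + 1616 * (((F.P K).d + 2 : ℕ) : ℝ)) * ∑ j ∈ Finset.range k, α j)) * ((F.P K).L : ℝ) ^ k) * (ℓ * c₀)) + 2 * (∑ i ∈ Finset.range k, ((1 + 4 * (((F.P K).d + 2 : ℕ) : ℝ)) * Real.exp ((((F.P K).d + 2 : ℕ) : ℝ) * (422 + 1616 * (((F.P K).d + 2 : ℕ) : ℝ)) * ∑ j ∈ Finset.range k, α j)) * ((F.P K).L : ℝ) ^ (k - 1 - i) * r (i + 1)) := by positivity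
  exact hOSC_of_compositeLetters_lie (P := F.P K) hl hl2 (Averaging.iter (fun i => blockAvg (P := F.P K) (j := i) (expMeanLogSU (n := Fin N))) k U₀) (fun (Y : PBond (F.P K) 0 → (specialUnitaryLogChart (Fin N)).lie) (c : PBond (F.P K) k) => (((fderiv ℝ (fun (A : PBond (F.P K) 0 → (specialUnitaryLogChart (Fin N)).lie) (c : PBond (F.P K) k) => (isChartRep_specialUnitaryGroup (n := Fin N)).logChart (Averaging.iter (fun i => blockAvg (P := F.P K) (j := i) (expMeanLogSU (n := Fin N))) k (fun b => (isChartRep_specialUnitaryGroup (n := Fin N)).expChart (A b) * U₀ b) c * (Averaging.iter (fun i => blockAvg (P := F.P K) (j := i) (expMeanLogSU (n := Fin N))) k U₀ c)⁻¹)) 0) Y c : (specialUnitaryLogChart (Fin N)).lie) : Matrix (Fin N) (Fin N) ℂ)) (Xd 0) (Xd k) hpos hDlin hD hDcov hNL y' b b' hb hb' hdir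

end Summit.QuantumFields.YangMills.Theorems.FluctuationComparisonRegPrIntLS2BetaCovariantOscillationRegUpClosed

end
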